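import Summits.ResolutionOfSingularities.ResolutionOfSingularities.Theses.WeightedInvariant
import Literature.AlgebraicGeometry.Resolution.CobordantChartCoefficients

/-!
# `LocalWeightedDrop`, line `vertex-descent-weight-residues`: the tameness hypothesis of the
# tame slice is load-bearing (negative-side support, drefute seat)

Crux `stmt-ResolutionOfSingularities-8899`
(`Summit.ResolutionOfSingularities.ResolutionOfSingularities.Theses.WeightedInvariant.LocalWeightedDrop`),
line `vertex-descent-weight-residues`.  The planner's stub `stub_tameSlice` (now the lead's sorry-free glue
theorem `tameSlice`, assembled from the landed `stub_unitRoot`, `stub_tameSliceKappa`, `stub_sliceCyl`)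
says: at an exceptional point `c` of the cobordant chart `x ↦ s^w (c + y)` and an index `i` with `cᵢ ≠ 0`
and `p ∤ wᵢ` (TAME), every factor `g` of `F(s^w(c+y)) = sᵃ g` is `unit · Φ^*(cylinder over g|_{yᵢ = 0})`.

`tameSlice_false_without_tame` negates that statement with the single hypothesis `¬ p ∣ w i` DELETED
(written inline, verbatim otherwise; nothing new is declared under `Summits/` besides theorems).  It is
FALSE, sorry-free, by an explicit SINGULAR wild specimen in characteristic `2`:

* `F = x₁⁴ + x₂²`, weights `w = (1, 2)`, point `c = (1, 1)`, `a = 4`: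
  `F(s(1+y₁), s²(1+y₂)) = s⁴ (y₂² + y₁⁴)` over `ZMod 2` (`wild_chart`), so `g = y₂² + y₁⁴ = (y₂ + y₁²)²`
  is a singular `s`-saturated successor; the index `i = 2` is WILD (`c₂ = 1 ≠ 0`, `2 ∣ w₂ = 2`);
  the coordinate slice `g|_{y₂ = 0} = y₁⁴` (`wild_slice`, `wild_cyl`) has order `4`, whereas
  `coeff_{y₂²} g = 1`, and `u · Φ^*(y₁⁴) = u · (Φ y₁)⁴` has order `≥ 4` for every `Φ` with zero
  constant terms — so no `(Φ, u)` exists.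

This is the formal-germ form of Abramovich–Quek–Schober, arXiv:2412.16426, Remark 5.7 (p. 11: "If
`p ∣ wᵢ` the corresponding chart only has a flat slice, which does not preserve singularities").
Moral for the lead: (i) `¬ p ∣ wᵢ` cannot be dropped from the tame slice, even for singular successors
and even when `g` IS a cylinder in other coordinates (here index `1` is tame, `w₁ = 1`, and indeed
`g = (y₂ + y₁²)² ≅ cyl (y₂²)` as the tame slice predicts at `i = 1`): at a wild index the torus orbit
through `c` is tangent to the hyperplane `yᵢ = 0` (`∂_λ (λ^{wᵢ}(cᵢ + yᵢ))|_{λ=1} = wᵢ cᵢ = 0` in `k`), so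
the COORDINATE slice is not a slice; (ii) the order of the coordinate slice can jump UP at a wild index,
so no admissible rank may be read off `g|_{yᵢ = 0}` at wild `i` — the wild clause of `stub_hornedRank`
must indeed see the honest `(n+1)`-variable successor.
-/

set_option linter.dupNamespace false -- mandated namespace of this single-conjunct summit

namespace Summit.ResolutionOfSingularities.ResolutionOfSingularities.Theorems.LocalWeightedDrop.Negative

open Literature.AlgebraicGeometry.Resolution

/-- `2 = 0` in `(ZMod 2)[[s, y₁, y₂]]`. [folklore] -/
theorem two_eq_zero : (2 : MvPowerSeries (Fin 3) (ZMod 2)) = 0 := by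
  rw [← map_ofNat (MvPowerSeries.C (σ := Fin 3) (R := ZMod 2)) 2]
  have : (OfNat.ofNat 2 : ZMod 2) = 0 := by decide
  rw [this, map_zero]

/-- The crux convention `wᵢ = 0 → cᵢ = 0` for the specimen `w = (1,2)`, `c = (1,1)` (vacuous). [folklore] -/
theorem wild_convention : ∀ i : Fin 2, (![1, 2] : Fin 2 → ℕ) i = 0 → (![1, 1] : Fin 2 → ZMod 2) i = 0 := by
  intro i hi
  fin_cases i <;> simp at hi

/-- The chart identity `F(s(1+y₁), s²(1+y₂)) = s⁴ · (y₂² + y₁⁴)` for `F = x₁⁴ + x₂²` in characteristic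
`2`. [folklore] -/
theorem wild_chart :
    MvPowerSeries.subst (CobordantChart.chart (![1, 2] : Fin 2 → ℕ) (![1, 1] : Fin 2 → ZMod 2))
      (MvPowerSeries.X 0 ^ 4 + MvPowerSeries.X 1 ^ 2 : MvPowerSeries (Fin 2) (ZMod 2)) =
    MvPowerSeries.X 0 ^ 4 * (MvPowerSeries.X 2 ^ 2 + MvPowerSeries.X 1 ^ 4) := by
  have hs := CobordantChart.hasSubst_chart (![1, 2] : Fin 2 → ℕ) (![1, 1] : Fin 2 → ZMod 2) wild_convention
  rw [MvPowerSeries.subst_add hs, MvPowerSeries.subst_pow hs, MvPowerSeries.subst_pow hs,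
    MvPowerSeries.subst_X hs, MvPowerSeries.subst_X hs, CobordantChart.chart_apply,
    CobordantChart.chart_apply]
  simp only [Matrix.cons_val_zero, Matrix.cons_val_one, Fin.succ_zero_eq_one, Fin.succ_one_eq_two,
    map_one, pow_one]
  linear_combination
    (MvPowerSeries.X 0 ^ 4 * (1 + 2 * MvPowerSeries.X 1 + 3 * MvPowerSeries.X 1 ^ 2
      + 2 * MvPowerSeries.X 1 ^ 3 + MvPowerSeries.X 2)) * two_eq_zero

/-- The coordinate slice of `g = y₂² + y₁⁴` at the wild index (kill `y₂ = X 2`, renumber to two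
variables) is `y₁⁴`. [folklore] -/
theorem wild_slice :
    MvPowerSeries.subst (fun j : Fin (2 + 1) => if j = (1 : Fin 2).succ then (0 : MvPowerSeries (Fin 2) (ZMod 2))
      else MvPowerSeries.X (Fin.predAbove 1 j))
      (MvPowerSeries.X 2 ^ 2 + MvPowerSeries.X 1 ^ 4 : MvPowerSeries (Fin (2 + 1)) (ZMod 2)) =
    MvPowerSeries.X 1 ^ 4 := by
  have hs : MvPowerSeries.HasSubst (fun j : Fin (2 + 1) => if j = (1 : Fin 2).succ then
      (0 : MvPowerSeries (Fin 2) (ZMod 2)) else MvPowerSeries.X (Fin.predAbove 1 j)) :=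
    MvPowerSeries.hasSubst_of_constantCoeff_zero fun j => by
      split_ifs <;> simp [MvPowerSeries.constantCoeff_X]
  rw [MvPowerSeries.subst_add hs, MvPowerSeries.subst_pow hs, MvPowerSeries.subst_pow hs,
    MvPowerSeries.subst_X hs, MvPowerSeries.subst_X hs]
  have h2 : (2 : Fin (2 + 1)) = (1 : Fin 2).succ := by decide
  have h1 : (1 : Fin (2 + 1)) ≠ (1 : Fin 2).succ := by decide
  have hp : Fin.predAbove (1 : Fin 2) (1 : Fin (2 + 1)) = 1 := by decide
  simp only [h2, if_true, h1, if_false, hp]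
  ring

/-- The cylinder over `y₁⁴` (re-embed into three variables skipping `X 2`) is `y₁⁴`. [folklore] -/
theorem wild_cyl :
    MvPowerSeries.subst (fun m : Fin 2 => (MvPowerSeries.X ((Fin.succ (1 : Fin 2)).succAbove m) :
      MvPowerSeries (Fin (2 + 1)) (ZMod 2))) (MvPowerSeries.X 1 ^ 4 : MvPowerSeries (Fin 2) (ZMod 2)) =
      MvPowerSeries.X 1 ^ 4 := by
  have hs : MvPowerSeries.HasSubst (fun m : Fin 2 => (MvPowerSeries.X ((Fin.succ (1 : Fin 2)).succAbove m) :
      MvPowerSeries (Fin (2 + 1)) (ZMod 2))) :=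
    MvPowerSeries.hasSubst_of_constantCoeff_zero fun m => by simp [MvPowerSeries.constantCoeff_X]
  rw [MvPowerSeries.subst_pow hs, MvPowerSeries.subst_X hs]
  have : (Fin.succ (1 : Fin 2)).succAbove 1 = (1 : Fin (2 + 1)) := by decide
  rw [this]

/-- Refutes the TAME SLICE statement of line `vertex-descent-weight-residues` (crux `LocalWeightedDrop`,
stmt-ResolutionOfSingularities-8899; planner's `stub_tameSlice` = lead's glue `tameSlice`) WITHOUT its
tameness hypothesis `¬ p ∣ w i` [stub-hypothesis load-bearing]: with that hypothesis deleted the statement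
is false.  Witness `p = 2`, `k = ZMod 2`, `n = 2`, `F = x₁⁴ + x₂²`, `w = (1,2)`, `c = (1,1)`, `a = 4`,
`g = y₂² + y₁⁴`, wild index `i = 1` (second coordinate): the coordinate slice `y₁⁴` has order
`4 > 2 = ord g`.  The tame statement itself is TRUE (landed: `tameSlice` in the lead's skeleton from
`stub_unitRoot`/`stub_tameSliceKappa`/`stub_sliceCyl`); this theorem only certifies that the
hypothesis cannot be weakened (AQS arXiv:2412.16426 Rem. 5.7, formal-germ form). [folklore] -/
theorem tameSlice_false_without_tame :
    ¬ (∀ (p : ℕ), p.Prime → ∀ (k : Type) [Field k] [CharP k p] (n : ℕ) (F : MvPowerSeries (Fin n) k)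
      (w : Fin n → ℕ) (c : Fin n → k), (∀ i, w i = 0 → c i = 0) → ∀ (a : ℕ) (g : MvPowerSeries (Fin (n + 1)) k),
      MvPowerSeries.subst (CobordantChart.chart w c) F = MvPowerSeries.X 0 ^ a * g → ∀ i : Fin n, c i ≠ 0 →
      ∃ (Φ : Fin (n + 1) → MvPowerSeries (Fin (n + 1)) k) (u : MvPowerSeries (Fin (n + 1)) k),
        (∀ j, MvPowerSeries.constantCoeff (Φ j) = 0) ∧
        IsUnit (Matrix.det (Matrix.of fun j l => MvPowerSeries.coeff (Finsupp.single l 1) (Φ j))) ∧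
        MvPowerSeries.constantCoeff u ≠ 0 ∧
        g = u * MvPowerSeries.subst Φ (MvPowerSeries.subst
          (fun m : Fin n => (MvPowerSeries.X ((Fin.succ i).succAbove m) : MvPowerSeries (Fin (n + 1)) k))
          (MvPowerSeries.subst (fun j : Fin (n + 1) => if j = i.succ then (0 : MvPowerSeries (Fin n) k)
            else MvPowerSeries.X (Fin.predAbove i j)) g))) := by
  intro h
  have hc1 : (![1, 1] : Fin 2 → ZMod 2) 1 ≠ 0 := by simp
  obtain ⟨Φ, u, hΦ0, -, -, hg⟩ :=
    h 2 Nat.prime_two (ZMod 2) 2 _ _ _ wild_convention 4 _ wild_chart 1 hc1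
  rw [wild_slice, wild_cyl] at hg
  have hΦs := MvPowerSeries.hasSubst_of_constantCoeff_zero hΦ0
  rw [MvPowerSeries.subst_pow hΦs, MvPowerSeries.subst_X hΦs] at hg
  -- the right-hand side has order ≥ 4
  have h1 : (1 : ℕ∞) ≤ (Φ 1).order :=
    (MvPowerSeries.one_le_order_iff_constCoeff_eq_zero).mpr (hΦ0 1)
  have h4 : (4 : ℕ∞) ≤ (u * Φ 1 ^ 4).order := by
    calc (4 : ℕ∞) = 4 • (1 : ℕ∞) := by norm_num
      _ ≤ 4 • (Φ 1).order := nsmul_le_nsmul_right h1 4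
      _ ≤ (Φ 1 ^ 4).order := MvPowerSeries.le_order_pow 4
      _ ≤ u.order + (Φ 1 ^ 4).order := le_add_self
      _ ≤ (u * Φ 1 ^ 4).order := MvPowerSeries.le_order_mul
  -- but the coefficient of `y₂²` on the left is `1`
  have hcoeff : MvPowerSeries.coeff (Finsupp.single (2 : Fin 3) 2)
      (MvPowerSeries.X 2 ^ 2 + MvPowerSeries.X 1 ^ 4 : MvPowerSeries (Fin (2 + 1)) (ZMod 2)) = 1 := by
    rw [map_add, MvPowerSeries.X_pow_eq, MvPowerSeries.X_pow_eq, MvPowerSeries.coeff_monomial,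
      MvPowerSeries.coeff_monomial, if_pos rfl, if_neg]
    · simp
    · intro heq
      have := Finsupp.ext_iff.mp heq 2
      simp at this
  have hzero : MvPowerSeries.coeff (Finsupp.single (2 : Fin 3) 2) (u * Φ 1 ^ 4) = 0 := by
    apply MvPowerSeries.coeff_of_lt_order
    refine lt_of_lt_of_le ?_ h4
    rw [Finsupp.degree_single]
    norm_num
  rw [← hg, hcoeff] at hzero
  exact one_ne_zero hzero

end Summit.ResolutionOfSingularities.ResolutionOfSingularities.Theorems.LocalWeightedDrop.Negative
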